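import Summits.QuantumFields.YangMills.Theorems.LuscherReductionRunningReductionKTRCalibration
import Summits.QuantumFields.YangMills.Theorems.LuscherReductionRunningReductionKTRCertificate
import Summits.QuantumFields.YangMills.Theorems.LuscherReductionRunningReductionKTPhysSpace
import Summits.QuantumFields.YangMills.Theorems.FemtoTransferGapGroundState
import Summits.QuantumFields.YangMills.Theorems.LuscherReductionOneSiteLevelsClosed
import HarnessLib

/-!
# Crux RED `RunningReduction` (stmt-QuantumFields-19978), line «KTR», stub `stub_dressedRitz` — the cut in OPERATOR LANGUAGE:
# `OperatorPlateau → OrthoPlateau → ExcitedPlateau` (kernel-checked) and the certificate `RED → ONE → OperatorPlateau`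

Crux-ideate seat `ym-cruxidea-19978-1` (card `kato-temple-precision-transfer-r3`), GEN 6.  Workfile for `Cruxes/RunningReduction/Lines/`;
imports are tree-built Theorems only; sorry-free.  Companion of `Lines/VacuumDictionary.lean` (same seat, same gen).

THE CHAIN (all kernel-checked; texts byte-identical where they meet):
`OperatorPlateau → OrthoPlateau →(this file) ExcitedPlateau →(Lines/DressedRitzGEVP.lean rev 3) DiagonalPlateau → RitzGenerators → DressedRitz`
(= `KT.stub_dressedRitz` of «KTR» rev 7, registered).  `ExcitedPlateau` below is a VERBATIM copy of the body of `KTGen.ExcitedPlateau`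
(tree `Lines/DressedRitzGEVP.lean` rev 3, commit 360006f88f08 — that module is not importable on the farm snapshot yet, hence the copy;
`KTGen.dressedRitz_of_excitedPlateau h` accepts `h : OpPlat.ExcitedPlateau` by definitional unfolding).

WHAT CHANGES FOR THE PROVER.  `ExcitedPlateau` asks for `k` physical UNIT vectors `w_i` with Hilbert-space clauses (x1)–(x7).  The natural
witnesses are `w_i = u_i/‖u_i‖` with `u_i ⟂ Ω` EXACTLY — e.g. `u_i = (O_i − ⟨O_i⟩_Ω)·Ω` for gauge-invariant zero-flux INSERTIONS `O_i`
(smeared ∕ flowed loop functionals) and the vacuum `Ω`.  `OrthoPlateau` is `ExcitedPlateau` rewritten HOMOGENEOUSLY in un-normalised vectors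
`u_i ⟂ φ` (clauses `PlateauClauses` (o0)–(o7): every quantity is one of the five vacuum-sector numbers `n_i = ‖u_i‖²`, `⟨u_i,u_l⟩`,
`d_il = ⟨u_i, K_β u_l⟩`, `‖K_β u_i‖² = ⟨u_i, K_β² u_i⟩`), and `OperatorPlateau` is the same with `u_i := ins φ O_i` produced from insertions.
Every normalisation, the Rayleigh quotients, the residual identity `‖Kw − ⟨w,Kw⟩w‖² = (‖Ku‖²‖u‖² − ⟨u,Ku⟩²)/‖u‖⁴` and clause (x3) (EXACT:
`⟨φ, u_i⟩ = 0`) are discharged here once (`excitedPlateau_of_orthoPlateau`).  By `Lines/VacuumDictionary.lean` (`tendsto_feynmanKac`) each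
vacuum number is the `m → ∞` limit of a ratio of two free-boundary slab path integrals with two insertions at time separation `t ∈ {0,1,2}`;
what is left to the prover is the RG estimate of those slab expectations in the femto window, uniformly in the slab length — the XL content.
NON-VACUITY: `operatorPlateau_of_runningReduction_oneSiteLevels : RED → ONE → OperatorPlateau` (witnesses: the Perron–Frobenius vacuum `Ω > 0`
of `exists_groundState` and the insertions `O_i := φ_{i+1}/Ω` built from the exact excited eigenfamily, which is `⟂ Ω` because `λ_{i+1} < λ₀`),
so the new cuts are implied by the route's two cruxes — satisfiable exactly when they hold, not over-strong.

* §0 raw helpers (`isPhys_mul/sub/div`, `l2_smul_smul`, `l2_smul_right'`, `qform_smul_smul`).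
* §1 `ins φ O = (O − ⟨φ, Oφ⟩)·φ`, `ins_eq`, `ins_div`, `isPhys_ins`, `l2_vac_ins : ⟨φ, ins φ O⟩ = 0` (`‖φ‖ = 1`).
* §2 `ExcitedPlateau` (verbatim copy), ★ `PlateauClauses`, ★ `OrthoPlateau`, ★ `OperatorPlateau`.
* §3 `residual_normSq`; ★★ `excitedPlateau_of_orthoPlateau`; `orthoPlateau_of_operatorPlateau`; ★★ `excitedPlateau_of_operatorPlateau`.
* §4 `plateauClauses_of_eigen`, `oneSiteCoupling_ge_of_small_level`, `spread_le_of_red_one` (the last two copied from `Lines/DressedRitzGEVP.lean` §8),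
  ★ `orthoPlateau_of_runningReduction_oneSiteLevels`, ★ `operatorPlateau_of_runningReduction_oneSiteLevels`; and — crux ONE being
  CLOSED (`FemtoTransferGap.oneSiteLevels_proof`, 2026-08-27 07:09Z) — the ONE-free forms ★ `orthoPlateau_of_runningReduction`,
  ★ `operatorPlateau_of_runningReduction : RunningReduction → OperatorPlateau` (the cut is implied by RED ALONE).

HONEST FRAMING: fixed-lattice linear algebra on the femto rung (R2b1); it re-expresses the registered stub's typed cut, proves no estimate, and has
no bearing on infinite volume, the continuum or the Clay problem.  References: M. Lüscher, NPB 219 (1983) [cite: Luscher1983]; M. Lüscher,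
U. Wolff, NPB 339 (1990) 222 (GEVP ∕ operator bases) [cite: LuscherWolff1990]; M. Reed, B. Simon IV, Thm. XIII.1 [cite: ReedSimonIV1978].
-/

set_option autoImplicit false

noncomputable section

open MeasureTheory Filter Topology Real
open Literature.MathematicalPhysics.QuantumFieldTheory
open Literature.MathematicalPhysics.QuantumLattice
open Literature.Analysis.OperatorTheory.YMMatrixModel
open scoped BigOperators

namespace Summit.QuantumFields.YangMills.Cruxes.RunningReduction.OpPlat

open Summit.QuantumFields.YangMills.Theorems.FemtoTransferGap
open Summit.QuantumFields.YangMills.Theorems.FemtoTransferGap.KTRCalibration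
open Summit.QuantumFields.YangMills.Theorems.FemtoTransferGap.PhysL2

/-! ## §0 Raw helpers -/

section Raw
variable {L : ℕ}

/-- Products of physical zero-flux test functions are physical. [folklore] -/
theorem isPhys_mul {ψ φ : GaugeConfig 3 L Theorems.FemtoTransferGap.SU2 → ℝ} (hψ : IsPhys ψ) (hφ : IsPhys φ) : IsPhys (ψ * φ) where
  measurable := hψ.measurable.mul hφ.measurable
  bounded := by
    obtain ⟨C, hC⟩ := hψ.bounded
    obtain ⟨D, hD⟩ := hφ.bounded
    exact ⟨C * D, fun U => by
      rw [Pi.mul_apply, abs_mul]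
      exact mul_le_mul (hC U) (hD U) (abs_nonneg _) ((abs_nonneg _).trans (hC U))⟩
  gaugeInv := fun g U => by simp only [Pi.mul_apply, hψ.gaugeInv g U, hφ.gaugeInv g U]
  zeroFlux := fun k z hz U => by simp only [Pi.mul_apply, hψ.zeroFlux k z hz U, hφ.zeroFlux k z hz U]

/-- Differences of physical zero-flux test functions are physical. [folklore] -/
theorem isPhys_sub {ψ φ : GaugeConfig 3 L Theorems.FemtoTransferGap.SU2 → ℝ} (hψ : IsPhys ψ) (hφ : IsPhys φ) : IsPhys (ψ - φ) where
  measurable := hψ.measurable.sub hφ.measurable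
  bounded := by
    obtain ⟨C, hC⟩ := hψ.bounded
    obtain ⟨D, hD⟩ := hφ.bounded
    exact ⟨C + D, fun U => by
      rw [Pi.sub_apply]
      have h := abs_sub_le (ψ U) 0 (φ U)
      rw [sub_zero, zero_sub, abs_neg] at h
      exact h.trans (add_le_add (hC U) (hD U))⟩
  gaugeInv := fun g U => by simp only [Pi.sub_apply, hψ.gaugeInv g U, hφ.gaugeInv g U]
  zeroFlux := fun k z hz U => by simp only [Pi.sub_apply, hψ.zeroFlux k z hz U, hφ.zeroFlux k z hz U]

/-- The quotient `ψ/Ω` of a physical test function by a physical function bounded BELOW by `c > 0` (the Perron–Frobenius vacuum,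
`PhysL2.exists_groundState`) is physical. [folklore] -/
theorem isPhys_div {ψ Ω : GaugeConfig 3 L Theorems.FemtoTransferGap.SU2 → ℝ} (hψ : IsPhys ψ) (hΩ : IsPhys Ω) {c : ℝ} (hc : 0 < c) (hcle : ∀ U, c ≤ Ω U) :
    IsPhys (ψ / Ω) where
  measurable := hψ.measurable.div hΩ.measurable
  bounded := by
    obtain ⟨B, hB⟩ := hψ.bounded
    refine ⟨B / c, fun U => ?_⟩
    have hΩU : c ≤ Ω U := hcle U
    have hΩpos : 0 < Ω U := hc.trans_le hΩU
    have hB0 : 0 ≤ B := (abs_nonneg _).trans (hB U)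
    rw [Pi.div_apply, abs_div, abs_of_pos hΩpos, div_le_iff₀ hΩpos]
    calc |ψ U| ≤ B := hB U
      _ = B / c * c := (div_mul_cancel₀ B hc.ne').symm
      _ ≤ B / c * Ω U := mul_le_mul_of_nonneg_left hΩU (div_nonneg hB0 hc.le)
  gaugeInv := fun g U => by simp only [Pi.div_apply, hψ.gaugeInv g U, hΩ.gaugeInv g U]
  zeroFlux := fun k z hz U => by simp only [Pi.div_apply, hψ.zeroFlux k z hz U, hΩ.zeroFlux k z hz U]

variable [NeZero L]

/-- `⟨aψ, bφ⟩ = ab⟨ψ, φ⟩`. [folklore] -/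
theorem l2_smul_smul (a b : ℝ) (ψ φ : GaugeConfig 3 L Theorems.FemtoTransferGap.SU2 → ℝ) : l2 (a • ψ) (b • φ) = a * b * l2 ψ φ := by
  rw [l2_smul_left, l2_comm, l2_smul_left, l2_comm]
  ring

/-- `⟨ψ, cη⟩ = c⟨ψ, η⟩`. [folklore] -/
theorem l2_smul_right' (c : ℝ) (ψ η : GaugeConfig 3 L Theorems.FemtoTransferGap.SU2 → ℝ) : l2 ψ (c • η) = c * l2 ψ η := by
  rw [l2_comm, l2_smul_left, l2_comm]

/-- `qform(aψ, bφ) = ab·qform(ψ, φ)`. [folklore] -/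
theorem qform_smul_smul (β a b : ℝ) (ψ φ : GaugeConfig 3 L Theorems.FemtoTransferGap.SU2 → ℝ) :
    qform su2Rep β (a • ψ) (b • φ) = a * b * qform su2Rep β ψ φ := by
  rw [qform_eq_l2_transferApply, qform_eq_l2_transferApply, transferApply_smul, l2_smul_smul]

end Raw

/-! ## §1 Vacuum-subtracted insertions applied to the vacuum -/

section Objects
variable {L : ℕ}

/-- **`ins φ O = (O − ⟨φ, O·φ⟩)·φ`** — the insertion `O`, vacuum-subtracted with respect to the unit vector `φ` (the vacuum), applied to `φ`.
[cite: LuscherWolff1990] -/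
def ins [NeZero L] (φ O : GaugeConfig 3 L Theorems.FemtoTransferGap.SU2 → ℝ) : GaugeConfig 3 L Theorems.FemtoTransferGap.SU2 → ℝ :=
  (O - fun _ => l2 φ (O * φ)) * φ

variable [NeZero L]

/-- `ins φ O` is physical for physical `φ`, `O`. [folklore] -/
theorem isPhys_ins {φ O : GaugeConfig 3 L Theorems.FemtoTransferGap.SU2 → ℝ} (hφ : IsPhys φ) (hO : IsPhys O) : IsPhys (ins φ O) :=
  isPhys_mul (isPhys_sub hO (isPhys_const _)) hφ

/-- `ins φ O = O·φ − ⟨φ, O·φ⟩•φ`. [folklore] -/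
theorem ins_eq (φ O : GaugeConfig 3 L Theorems.FemtoTransferGap.SU2 → ℝ) : ins φ O = O * φ - l2 φ (O * φ) • φ := by
  funext U
  simp only [ins, Pi.mul_apply, Pi.sub_apply, Pi.smul_apply, smul_eq_mul]
  ring

/-- For a nowhere-vanishing vacuum, the insertion `ψ/Ω` produces `ins Ω (ψ/Ω) = ψ − ⟨Ω, ψ⟩•Ω` — every vector `⟂ Ω` is an `ins`. [folklore] -/
theorem ins_div {Ω : GaugeConfig 3 L Theorems.FemtoTransferGap.SU2 → ℝ} (hΩ : ∀ U, Ω U ≠ 0) (ψ : GaugeConfig 3 L Theorems.FemtoTransferGap.SU2 → ℝ) :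
    ins Ω (ψ / Ω) = ψ - l2 Ω ψ • Ω := by
  have hmul : ψ / Ω * Ω = ψ := funext fun U => by
    rw [Pi.mul_apply, Pi.div_apply, div_mul_cancel₀ (ψ U) (hΩ U)]
  rw [ins_eq, hmul]

/-- ★ Clause (x3) is EXACT for subtracted insertions: `⟨φ, ins φ O⟩ = 0` whenever `‖φ‖² = 1`. [folklore] -/
theorem l2_vac_ins {φ O : GaugeConfig 3 L Theorems.FemtoTransferGap.SU2 → ℝ} (hφ : IsPhys φ) (hO : IsPhys O) (hφ1 : l2 φ φ = 1) : l2 φ (ins φ O) = 0 := by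
  -- in the `physSubmodule` currency, where `l2Form` is bilinear with no side conditions
  set Φ : physSubmodule L := ⟨φ, hφ⟩ with hΦ
  set OΦ : physSubmodule L := ⟨O * φ, isPhys_mul hO hφ⟩ with hOΦ
  have hins : (ins φ O) = ((OΦ - l2 φ (O * φ) • Φ : physSubmodule L) : GaugeConfig 3 L Theorems.FemtoTransferGap.SU2 → ℝ) := by
    rw [ins_eq]; rfl
  have h : l2Form L Φ (OΦ - l2 φ (O * φ) • Φ) = 0 := by
    rw [map_sub, map_smul, smul_eq_mul, l2Form_apply, l2Form_apply]
    show l2 φ (O * φ) - l2 φ (O * φ) * l2 φ φ = 0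
    rw [hφ1, mul_one, sub_self]
  rw [hins]
  exact h

end Objects

/-! ## §2 The cuts: `ExcitedPlateau` (verbatim), `PlateauClauses`, `OrthoPlateau`, `OperatorPlateau` -/

/-- VERBATIM COPY of the body of `KTGen.ExcitedPlateau` (tree `Cruxes/RunningReduction/Lines/DressedRitzGEVP.lean` rev 3, §9): the
excited-sector GEVP-free cut under `stub_dressedRitz` — `k` physical unit vectors, (x1) sorted diagonal values, (x2) almost orthogonal,
(x3) almost orthogonal to an exact unit top eigenvector, (x4) one-step residuals `O(λ³/L²)λ₀²`, (x5) Lüscher positions against the one-site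
levels `μ_{i+1}`, (x6) pairwise couplings `O(λ²/L)λ₀`, (x7) one-loop spread `O(λ/L)λ₀`. [cite: Luscher1983] -/
def ExcitedPlateau : Prop :=
  ∀ k : ℕ, ∃ C lam0 : ℝ, 0 < lam0 ∧ ∀ lam : ℝ, 0 < lam → lam ≤ lam0 → ∃ L0 : ℕ,
    ∀ (L : ℕ) [NeZero L], L0 ≤ L → ∀ β : ℝ, InFemtoWindow lam β L →
      ∃ w : Fin k → (GaugeConfig 3 L Theorems.FemtoTransferGap.SU2 → ℝ),
        (∀ i, IsPhys (w i)) ∧ (∀ i, l2 (w i) (w i) = 1) ∧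
        (∀ i l : Fin k, i ≤ l → qform su2Rep β (w l) (w l) ≤ qform su2Rep β (w i) (w i)) ∧
        (∀ i l : Fin k, i ≠ l → |l2 (w i) (w l)| ≤ C * luscherLambda β L) ∧
        (∃ φ : GaugeConfig 3 L Theorems.FemtoTransferGap.SU2 → ℝ, IsPhys φ ∧ l2 φ φ = 1 ∧
            transferApply β φ = levelValue su2Rep L β 0 • φ ∧ ∀ i, |l2 φ (w i)| ≤ C * luscherLambda β L) ∧
        (∀ i, l2 (transferApply β (w i) - qform su2Rep β (w i) (w i) • w i)
            (transferApply β (w i) - qform su2Rep β (w i) (w i) • w i)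
            ≤ C * (luscherLambda β L ^ 3 / (L : ℝ) ^ 2) * levelValue su2Rep L β 0 ^ 2) ∧
        (∀ i : Fin k,
          qform su2Rep β (w i) (w i) * levelValue su2Rep 1 (oneSiteCoupling β L) 0 ≤
              Real.exp (C * luscherLambda β L ^ 2 / L) *
                (levelValue su2Rep 1 (oneSiteCoupling β L) ((i : ℕ) + 1) * levelValue su2Rep L β 0) ∧
          levelValue su2Rep 1 (oneSiteCoupling β L) ((i : ℕ) + 1) * levelValue su2Rep L β 0 ≤
              Real.exp (C * luscherLambda β L ^ 2 / L) *
                (qform su2Rep β (w i) (w i) * levelValue su2Rep 1 (oneSiteCoupling β L) 0)) ∧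
        (∀ i l : Fin k, i ≠ l →
          |qform su2Rep β (w i) (w l) - (qform su2Rep β (w i) (w i) + qform su2Rep β (w l) (w l)) / 2 * l2 (w i) (w l)|
            ≤ C * (luscherLambda β L ^ 2 / L) * levelValue su2Rep L β 0) ∧
        (∀ i : Fin k, levelValue su2Rep L β 0 - qform su2Rep β (w i) (w i)
            ≤ C * (luscherLambda β L / L) * levelValue su2Rep L β 0)


/-- ★ **THE HOMOGENEOUS CLAUSES (o0)–(o7)** for `k` raw vectors `u_i` at coupling `β` with constant `C` — write `n_i := ⟨u_i,u_i⟩`,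
`d_il := ⟨u_i, K_β u_l⟩`, `λ := luscherLambda β L`, `λ₀ := levelValue su2Rep L β 0`, `μ_j := levelValue su2Rep 1 (oneSiteCoupling β L) j`:
(o0) `n_i > 0`; (o1) ORDER `i ≤ l → d_ll·n_i ≤ d_ii·n_l`; (o2) `|⟨u_i,u_l⟩| ≤ Cλ·√n_i√n_l` (`i ≠ l`); (o4) RESIDUAL `‖K_βu_i‖²·n_i − d_ii² ≤
C(λ³/L²)λ₀²·n_i²`; (o5) LÜSCHER POSITION `d_ii·μ₀ ≤ e^{Cλ²/L}(μ_{i+1}λ₀)·n_i` and `(μ_{i+1}λ₀)·n_i ≤ e^{Cλ²/L}·d_ii·μ₀`; (o6) COUPLING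
`|d_il − ½(d_ii/n_i + d_ll/n_l)⟨u_i,u_l⟩| ≤ C(λ²/L)λ₀·√n_i√n_l` (`i ≠ l`); (o7) SPREAD `λ₀·n_i − d_ii ≤ C(λ/L)λ₀·n_i`.  Every quantity is a
vacuum-sector correlator of two vectors at time separation `0, 1, 2` (`‖K_βu‖² = ⟨u, K_β²u⟩`). [cite: LuscherWolff1990] -/
def PlateauClauses (k : ℕ) (C : ℝ) {L : ℕ} [NeZero L] (β : ℝ) (u : Fin k → (GaugeConfig 3 L Theorems.FemtoTransferGap.SU2 → ℝ)) : Prop :=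
  (∀ i : Fin k, 0 < l2 (u i) (u i)) ∧
  (∀ i l : Fin k, i ≤ l →
    l2 (u l) (transferApply β (u l)) * l2 (u i) (u i) ≤ l2 (u i) (transferApply β (u i)) * l2 (u l) (u l)) ∧
  (∀ i l : Fin k, i ≠ l →
    |l2 (u i) (u l)| ≤ C * luscherLambda β L * (Real.sqrt (l2 (u i) (u i)) * Real.sqrt (l2 (u l) (u l)))) ∧
  (∀ i : Fin k,
    l2 (transferApply β (u i)) (transferApply β (u i)) * l2 (u i) (u i) - l2 (u i) (transferApply β (u i)) ^ 2
      ≤ C * (luscherLambda β L ^ 3 / (L : ℝ) ^ 2) * levelValue su2Rep L β 0 ^ 2 * l2 (u i) (u i) ^ 2) ∧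
  (∀ i : Fin k,
    l2 (u i) (transferApply β (u i)) * levelValue su2Rep 1 (oneSiteCoupling β L) 0 ≤
        Real.exp (C * luscherLambda β L ^ 2 / L) *
          (levelValue su2Rep 1 (oneSiteCoupling β L) ((i : ℕ) + 1) * levelValue su2Rep L β 0) * l2 (u i) (u i) ∧
    levelValue su2Rep 1 (oneSiteCoupling β L) ((i : ℕ) + 1) * levelValue su2Rep L β 0 * l2 (u i) (u i) ≤
        Real.exp (C * luscherLambda β L ^ 2 / L) *
          (l2 (u i) (transferApply β (u i)) * levelValue su2Rep 1 (oneSiteCoupling β L) 0)) ∧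
  (∀ i l : Fin k, i ≠ l →
    |l2 (u i) (transferApply β (u l)) -
        (l2 (u i) (transferApply β (u i)) / l2 (u i) (u i) + l2 (u l) (transferApply β (u l)) / l2 (u l) (u l)) / 2 *
          l2 (u i) (u l)|
      ≤ C * (luscherLambda β L ^ 2 / L) * levelValue su2Rep L β 0 *
          (Real.sqrt (l2 (u i) (u i)) * Real.sqrt (l2 (u l) (u l)))) ∧
  (∀ i : Fin k, levelValue su2Rep L β 0 * l2 (u i) (u i) - l2 (u i) (transferApply β (u i))
      ≤ C * (luscherLambda β L / L) * levelValue su2Rep L β 0 * l2 (u i) (u i))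

/-- ★ **THE CUT IN HOMOGENEOUS FORM (`OrthoPlateau`).**  For each `k`: `C ≥ 0`, `lam0 > 0`; in the femto window a physical unit top
eigenvector `φ` of `K_β` and `k` physical vectors `u_i` EXACTLY orthogonal to `φ` satisfying `PlateauClauses` — no unit vectors, no (x3).
[cite: Luscher1983] -/
def OrthoPlateau : Prop :=
  ∀ k : ℕ, ∃ C lam0 : ℝ, 0 ≤ C ∧ 0 < lam0 ∧ ∀ lam : ℝ, 0 < lam → lam ≤ lam0 → ∃ L0 : ℕ,
    ∀ (L : ℕ) [NeZero L], L0 ≤ L → ∀ β : ℝ, InFemtoWindow lam β L →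
      ∃ φ : GaugeConfig 3 L Theorems.FemtoTransferGap.SU2 → ℝ, IsPhys φ ∧ l2 φ φ = 1 ∧
        transferApply β φ = levelValue su2Rep L β 0 • φ ∧
      ∃ u : Fin k → (GaugeConfig 3 L Theorems.FemtoTransferGap.SU2 → ℝ), (∀ i, IsPhys (u i)) ∧ (∀ i, l2 φ (u i) = 0) ∧ PlateauClauses k C β u

/-- ★ **THE CUT IN OPERATOR LANGUAGE (`OperatorPlateau`).**  As `OrthoPlateau`, but the vectors are PRODUCED from `k` physical insertions:
`u_i := ins φ O_i = (O_i − ⟨O_i⟩_φ)·φ` (orthogonality to `φ` is then automatic, `l2_vac_ins`).  This is the statement a prover working with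
smeared-loop operator bases (Lüscher–Wolff) actually establishes. [cite: LuscherWolff1990] -/
def OperatorPlateau : Prop :=
  ∀ k : ℕ, ∃ C lam0 : ℝ, 0 ≤ C ∧ 0 < lam0 ∧ ∀ lam : ℝ, 0 < lam → lam ≤ lam0 → ∃ L0 : ℕ,
    ∀ (L : ℕ) [NeZero L], L0 ≤ L → ∀ β : ℝ, InFemtoWindow lam β L →
      ∃ φ : GaugeConfig 3 L Theorems.FemtoTransferGap.SU2 → ℝ, IsPhys φ ∧ l2 φ φ = 1 ∧
        transferApply β φ = levelValue su2Rep L β 0 • φ ∧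
      ∃ O : Fin k → (GaugeConfig 3 L Theorems.FemtoTransferGap.SU2 → ℝ), (∀ i, IsPhys (O i)) ∧ PlateauClauses k C β (fun i => ins φ (O i))

/-! ## §3 `OperatorPlateau → OrthoPlateau → ExcitedPlateau` -/

section Reduction
variable {L : ℕ} [NeZero L]

/-- The residual identity for `w = c•u`, `q` real: `‖K w − q•w‖² = c²(‖Ku‖² − 2q⟨u,Ku⟩ + q²‖u‖²)`. [folklore] -/
theorem residual_normSq (β : ℝ) {u : GaugeConfig 3 L Theorems.FemtoTransferGap.SU2 → ℝ} (hu : IsPhys u) (c q : ℝ) :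
    l2 (transferApply β (c • u) - q • (c • u)) (transferApply β (c • u) - q • (c • u)) =
      c ^ 2 * (l2 (transferApply β u) (transferApply β u) - 2 * q * l2 u (transferApply β u) + q ^ 2 * l2 u u) := by
  set U : physSubmodule L := ⟨u, hu⟩ with hU
  have hcoe : transferApply β (c • u) - q • (c • u) =
      ((c • (transferOp β U - q • U) : physSubmodule L) : GaugeConfig 3 L Theorems.FemtoTransferGap.SU2 → ℝ) := by
    rw [transferApply_smul]
    simp only [Submodule.coe_smul, Submodule.coe_sub, coe_transferOp, smul_sub, smul_smul, mul_comm q c]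
    rfl
  have h : l2Form L (c • (transferOp β U - q • U)) (c • (transferOp β U - q • U)) =
      c ^ 2 * (l2Form L (transferOp β U) (transferOp β U) - 2 * q * l2Form L U (transferOp β U) + q ^ 2 * l2Form L U U) := by
    simp only [map_smul, map_sub, LinearMap.smul_apply, LinearMap.sub_apply, smul_eq_mul, transferOp_symm]
    ring
  rw [hcoe, ← l2Form_apply, h, l2Form_apply, l2Form_apply, l2Form_apply, coe_transferOp]

omit [NeZero L] in
/-- ★★ **`OrthoPlateau → ExcitedPlateau`** — witnesses `w_i := (√n_i)⁻¹ • u_i`, vacuum `φ`; constants unchanged. [cite: Luscher1983] -/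
theorem excitedPlateau_of_orthoPlateau (h : OrthoPlateau) : ExcitedPlateau := by
  intro k
  obtain ⟨C, lam0, hC0, hlam0, hC⟩ := h k
  refine ⟨C, lam0, hlam0, fun lam hlam hle => ?_⟩
  obtain ⟨L0, hL⟩ := hC lam hlam hle
  refine ⟨L0, fun L _ hL0 β hW => ?_⟩
  obtain ⟨φ, hφ, hφ1, hKφ, u, hu, hperp, hn0, h1, h2, h4, h5, h6, h7⟩ := hL L hL0 β hW
  have hlam_nn : 0 ≤ luscherLambda β L := luscherLambda_nonneg β L
  -- norms, one-step correlators, normalising constants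
  set n : Fin k → ℝ := fun i => l2 (u i) (u i) with hn_def
  have hn_eq : ∀ i, l2 (u i) (u i) = n i := fun i => rfl
  have hn0' : ∀ i, 0 < n i := hn0
  set d : Fin k → Fin k → ℝ := fun i l => l2 (u i) (transferApply β (u l)) with hd_def
  have hd_eq : ∀ i l, l2 (u i) (transferApply β (u l)) = d i l := fun i l => rfl
  set c : Fin k → ℝ := fun i => (Real.sqrt (n i))⁻¹ with hc_def
  have hsq : ∀ i, 0 < Real.sqrt (n i) := fun i => Real.sqrt_pos.mpr (hn0' i)
  have hc0 : ∀ i, 0 < c i := fun i => inv_pos.mpr (hsq i)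
  have hcs : ∀ i, c i * Real.sqrt (n i) = 1 := fun i => inv_mul_cancel₀ (hsq i).ne'
  have hcc : ∀ i, c i * c i * n i = 1 := fun i => by
    have hs : Real.sqrt (n i) * Real.sqrt (n i) = n i := Real.mul_self_sqrt (hn0' i).le
    calc c i * c i * n i = c i * c i * (Real.sqrt (n i) * Real.sqrt (n i)) := by rw [hs]
      _ = (c i * Real.sqrt (n i)) * (c i * Real.sqrt (n i)) := by ring
      _ = 1 := by rw [hcs i, mul_one]
  have hcc' : ∀ i, c i * c i = 1 / n i := fun i => by
    rw [eq_div_iff (hn0' i).ne']; exact hcc i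
  -- the witnesses
  set w : Fin k → (GaugeConfig 3 L Theorems.FemtoTransferGap.SU2 → ℝ) := fun i => c i • u i with hw_def
  have hl2w : ∀ i l, l2 (w i) (w l) = c i * c l * l2 (u i) (u l) := fun i l => l2_smul_smul _ _ _ _
  have hqw : ∀ i l, qform su2Rep β (w i) (w l) = c i * c l * d i l := fun i l => by
    rw [hw_def, qform_smul_smul, ← hd_eq, ← qform_eq_l2_transferApply]
  have hqd : ∀ i, qform su2Rep β (w i) (w i) = d i i / n i := fun i => by
    rw [hqw, hcc', one_div, ← div_eq_inv_mul]
  refine ⟨w, fun i => (hu i).smul _, fun i => ?_, fun i l hil => ?_, fun i l hil => ?_, ⟨φ, hφ, hφ1, hKφ, fun i => ?_⟩,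
    fun i => ?_, fun i => ?_, fun i l hil => ?_, fun i => ?_⟩
  · -- unit norm
    rw [hl2w, hn_eq, hcc]
  · -- (x1) from (o1)
    rw [hqd, hqd, div_le_div_iff₀ (hn0' l) (hn0' i)]
    exact h1 i l hil
  · -- (x2) from (o2)
    rw [hl2w, abs_mul, abs_mul, abs_of_pos (hc0 i), abs_of_pos (hc0 l)]
    calc c i * c l * |l2 (u i) (u l)|
        ≤ c i * c l * (C * luscherLambda β L * (Real.sqrt (n i) * Real.sqrt (n l))) :=
          mul_le_mul_of_nonneg_left (h2 i l hil) (mul_pos (hc0 i) (hc0 l)).le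
      _ = C * luscherLambda β L * ((c i * Real.sqrt (n i)) * (c l * Real.sqrt (n l))) := by ring
      _ = C * luscherLambda β L := by rw [hcs, hcs, mul_one, mul_one]
  · -- (x3): exact
    rw [hw_def]
    show |l2 φ (c i • u i)| ≤ _
    rw [l2_smul_right', hperp i, mul_zero, abs_zero]
    exact mul_nonneg hC0 hlam_nn
  · -- (x4) from (o4)
    rw [hw_def]
    show l2 (transferApply β (c i • u i) - qform su2Rep β (c i • u i) (c i • u i) • (c i • u i))
        (transferApply β (c i • u i) - qform su2Rep β (c i • u i) (c i • u i) • (c i • u i)) ≤ _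
    have hq : qform su2Rep β (c i • u i) (c i • u i) = d i i / n i := hqd i
    rw [hq, residual_normSq β (hu i), hd_eq, hn_eq]
    have hkey : c i ^ 2 * (l2 (transferApply β (u i)) (transferApply β (u i)) -
          2 * (d i i / n i) * d i i + (d i i / n i) ^ 2 * n i) =
        (l2 (transferApply β (u i)) (transferApply β (u i)) * n i - d i i ^ 2) / n i ^ 2 := by
      have hni : n i ≠ 0 := (hn0' i).ne'
      rw [sq (c i), hcc']
      field_simp
      ring
    rw [hkey, div_le_iff₀ (pow_pos (hn0' i) 2)]
    exact h4 i
  · -- (x5) from (o5)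
    obtain ⟨h5a, h5b⟩ := h5 i
    refine ⟨?_, ?_⟩
    · rw [hqd, div_mul_eq_mul_div, div_le_iff₀ (hn0' i)]
      exact h5a
    · rw [hqd, div_mul_eq_mul_div, ← mul_div_assoc, le_div_iff₀ (hn0' i)]
      exact h5b
  · -- (x6) from (o6)
    rw [hqw, hqd, hqd, hl2w]
    have hfac : c i * c l * d i l - (d i i / n i + d l l / n l) / 2 * (c i * c l * l2 (u i) (u l)) =
        (c i * c l) * (d i l - (d i i / n i + d l l / n l) / 2 * l2 (u i) (u l)) := by ring
    rw [hfac, abs_mul, abs_of_pos (mul_pos (hc0 i) (hc0 l))]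
    calc c i * c l * |d i l - (d i i / n i + d l l / n l) / 2 * l2 (u i) (u l)|
        ≤ c i * c l * (C * (luscherLambda β L ^ 2 / L) * levelValue su2Rep L β 0 *
            (Real.sqrt (n i) * Real.sqrt (n l))) :=
          mul_le_mul_of_nonneg_left (h6 i l hil) (mul_pos (hc0 i) (hc0 l)).le
      _ = C * (luscherLambda β L ^ 2 / L) * levelValue su2Rep L β 0 *
            ((c i * Real.sqrt (n i)) * (c l * Real.sqrt (n l))) := by ring
      _ = C * (luscherLambda β L ^ 2 / L) * levelValue su2Rep L β 0 := by rw [hcs, hcs, mul_one, mul_one]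
  · -- (x7) from (o7)
    rw [hqd, sub_le_iff_le_add, ← sub_le_iff_le_add', le_div_iff₀ (hn0' i), sub_mul]
    have := h7 i
    linarith

omit [NeZero L] in
/-- `OperatorPlateau → OrthoPlateau`: the subtracted insertions are exactly orthogonal to the vacuum (`l2_vac_ins`). [folklore] -/
theorem orthoPlateau_of_operatorPlateau (h : OperatorPlateau) : OrthoPlateau := by
  intro k
  obtain ⟨C, lam0, hC0, hlam0, hC⟩ := h k
  refine ⟨C, lam0, hC0, hlam0, fun lam hlam hle => ?_⟩
  obtain ⟨L0, hL⟩ := hC lam hlam hle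
  refine ⟨L0, fun L _ hL0 β hW => ?_⟩
  obtain ⟨φ, hφ, hφ1, hKφ, O, hO, hcl⟩ := hL L hL0 β hW
  exact ⟨φ, hφ, hφ1, hKφ, fun i => ins φ (O i), fun i => isPhys_ins hφ (hO i), fun i => l2_vac_ins hφ (hO i) hφ1, hcl⟩

omit [NeZero L] in
/-- ★★ **`OperatorPlateau → ExcitedPlateau`** (hence `→ DiagonalPlateau → RitzGenerators → DressedRitz = KT.stub_dressedRitz` by
`Lines/DressedRitzGEVP.lean`). [cite: LuscherWolff1990] -/
theorem excitedPlateau_of_operatorPlateau (h : OperatorPlateau) : ExcitedPlateau :=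
  excitedPlateau_of_orthoPlateau (orthoPlateau_of_operatorPlateau h)

end Reduction

/-! ## §4 NON-VACUITY: `RunningReduction → OneSiteLevels → OperatorPlateau` (and `→ OrthoPlateau`) -/

section Certificate
variable {L : ℕ} [NeZero L]

/-- The homogeneous clauses hold for the EXACT excited eigenfamily `u_i := φ_{i+1}` (`l2`-orthonormal, `K_βφ_j = λ_jφ_j`), given RED at levels
`j ≤ k` with a constant `C₁ ≤ C` and the level-`k` spread `λ₀ − λ_k ≤ C(λ/L)λ₀`: (o2), (o4), (o6) with value `0`, (o1) by `levelValue_antitone`,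
(o5) = RED, (o7) from the spread. [cite: ReedSimonIV1978, Thm. XIII.1] -/
theorem plateauClauses_of_eigen {k : ℕ} {C₁ C : ℝ} {β : ℝ} (hβ : 0 ≤ β) (hC0 : 0 ≤ C) (hCC : C₁ ≤ C)
    {φ : Fin (k + 1) → (GaugeConfig 3 L Theorems.FemtoTransferGap.SU2 → ℝ)}
    (hon : ∀ i l, l2 (φ i) (φ l) = if i = l then 1 else 0)
    (heig : ∀ i, transferApply β (φ i) = levelValue su2Rep L β i • φ i)
    (hRED : ∀ j : ℕ, j ≤ k →
      levelValue su2Rep L β j * levelValue su2Rep 1 (oneSiteCoupling β L) 0 ≤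
          Real.exp (C₁ * luscherLambda β L ^ 2 / L) * (levelValue su2Rep 1 (oneSiteCoupling β L) j * levelValue su2Rep L β 0) ∧
        levelValue su2Rep 1 (oneSiteCoupling β L) j * levelValue su2Rep L β 0 ≤
          Real.exp (C₁ * luscherLambda β L ^ 2 / L) * (levelValue su2Rep L β j * levelValue su2Rep 1 (oneSiteCoupling β L) 0))
    (hsp : levelValue su2Rep L β 0 - levelValue su2Rep L β k ≤ C * (luscherLambda β L / L) * levelValue su2Rep L β 0) :
    PlateauClauses k C β (fun i : Fin k => φ i.succ) := by
  have hB : 0 ≤ oneSiteCoupling β L := oneSiteCoupling_nonneg β L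
  have hlam_nn : 0 ≤ luscherLambda β L := luscherLambda_nonneg β L
  have hLnn : (0 : ℝ) ≤ (L : ℝ) := Nat.cast_nonneg L
  have ht2 : 0 ≤ luscherLambda β L ^ 2 / L := div_nonneg (sq_nonneg _) hLnn
  have ht3 : 0 ≤ luscherLambda β L ^ 3 / (L : ℝ) ^ 2 := div_nonneg (pow_nonneg hlam_nn 3) (sq_nonneg _)
  have hlv0 : 0 ≤ levelValue su2Rep L β 0 := levelValue_su2Rep_nonneg L hβ 0
  have hd : ∀ a b : Fin (k + 1), l2 (φ a) (transferApply β (φ b)) = if a = b then levelValue su2Rep L β b else 0 :=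
    fun a b => by rw [← qform_eq_l2_transferApply, qform_of_eigen_orthonormal hon heig]
  have hKK : ∀ a : Fin (k + 1), l2 (transferApply β (φ a)) (transferApply β (φ a)) = levelValue su2Rep L β a ^ 2 := fun a => by
    rw [heig a, l2_smul_smul, hon a a, if_pos rfl, mul_one, sq]
  have hsucc_le : ∀ i : Fin k, (i : ℕ) + 1 ≤ k := fun i => Nat.succ_le_of_lt i.2
  have hsqrt_nn : ∀ a b : Fin (k + 1), 0 ≤ Real.sqrt (l2 (φ a) (φ a)) * Real.sqrt (l2 (φ b) (φ b)) :=
    fun a b => mul_nonneg (Real.sqrt_nonneg _) (Real.sqrt_nonneg _)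
  refine ⟨fun i => ?_, fun i l hil => ?_, fun i l hil => ?_, fun i => ?_, fun i => ?_, fun i l hil => ?_, fun i => ?_⟩
  · -- (o0)
    rw [hon, if_pos rfl]; exact one_pos
  · -- (o1) sorted: `λ_{l+1} ≤ λ_{i+1}`
    rw [hd, if_pos rfl, hd, if_pos rfl, hon, if_pos rfl, hon, if_pos rfl, mul_one, mul_one]
    exact levelValue_antitone hβ (Fin.le_def.mp (Fin.succ_le_succ_iff.mpr hil))
  · -- (o2) exact orthogonality
    have hne : i.succ ≠ l.succ := fun h => hil (Fin.succ_injective _ h)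
    rw [hon, if_neg hne, abs_zero]
    exact mul_nonneg (mul_nonneg hC0 hlam_nn) (hsqrt_nn _ _)
  · -- (o4) zero residual
    rw [hKK, hd, if_pos rfl, hon, if_pos rfl, mul_one, sub_self, one_pow, mul_one]
    exact mul_nonneg (mul_nonneg hC0 ht3) (sq_nonneg _)
  · -- (o5) = RED at level `i+1 ≤ k`
    rw [hd, if_pos rfl, hon, if_pos rfl, mul_one, mul_one, Fin.val_succ]
    obtain ⟨ha, hb⟩ := hRED ((i : ℕ) + 1) (hsucc_le i)
    have hY₁ : 0 ≤ levelValue su2Rep 1 (oneSiteCoupling β L) ((i : ℕ) + 1) * levelValue su2Rep L β 0 :=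
      mul_nonneg (levelValue_su2Rep_nonneg 1 hB _) hlv0
    have hY₂ : 0 ≤ levelValue su2Rep L β ((i : ℕ) + 1) * levelValue su2Rep 1 (oneSiteCoupling β L) 0 :=
      mul_nonneg (levelValue_su2Rep_nonneg L hβ _) (levelValue_su2Rep_nonneg 1 hB 0)
    exact ⟨le_exp_mul_div_of_le ha ht2 hY₁ hCC, le_exp_mul_div_of_le hb ht2 hY₂ hCC⟩
  · -- (o6) zero couplings
    have hne : i.succ ≠ l.succ := fun h => hil (Fin.succ_injective _ h)
    rw [hd, if_neg hne, hon i.succ l.succ, if_neg hne, mul_zero, sub_zero, abs_zero]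
    exact mul_nonneg (mul_nonneg (mul_nonneg hC0 ht2) hlv0) (hsqrt_nn _ _)
  · -- (o7) spread at level `i+1 ≤ k`
    rw [hd, if_pos rfl, hon, if_pos rfl, mul_one, mul_one, Fin.val_succ]
    have hmono : levelValue su2Rep L β k ≤ levelValue su2Rep L β ((i : ℕ) + 1) := levelValue_antitone hβ (hsucc_le i)
    linarith

/-- (Copied from `Lines/DressedRitzGEVP.lean` §8.) In the femto window, a small level `lam ≤ 1/(4·max B₀ 1)` puts the effective one-site coupling
beyond any threshold `B₀`. [folklore] -/
theorem oneSiteCoupling_ge_of_small_level {B0 lam β : ℝ} (hlam : 0 < lam) (hlam1 : lam ≤ 1)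
    (hlamB : lam ≤ 1 / (4 * max B0 1)) (hW : InFemtoWindow lam β L) : B0 ≤ oneSiteCoupling β L := by
  have hB1 : 1 / (4 * lam ^ 3) ≤ oneSiteCoupling β L := oneSiteCoupling_ge_of_window hlam hW
  have hM1 : (1 : ℝ) ≤ max B0 1 := le_max_right _ _
  have hM0 : 0 < max B0 1 := zero_lt_one.trans_le hM1
  have hlam3 : lam ^ 3 ≤ lam := by
    have h1 : lam ^ 3 = lam * (lam * lam) := by ring
    rw [h1]
    have h2 : lam * lam ≤ 1 := by nlinarith
    nlinarith
  have h1 : max B0 1 ≤ 1 / (4 * lam) := by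
    rw [le_div_iff₀ (by positivity)]
    have := (le_div_iff₀ (by positivity : (0 : ℝ) < 4 * max B0 1)).mp hlamB
    linarith
  have h2 : 1 / (4 * lam) ≤ 1 / (4 * lam ^ 3) :=
    one_div_le_one_div_of_le (by positivity) (by linarith)
  exact (le_max_left B0 1).trans (h1.trans (h2.trans hB1))

omit [NeZero L] in
/-- (Copied from `Lines/DressedRitzGEVP.lean` §8.) **Relative spread from RED's and ONE's lower laws (pure real)**: `λ₀ − λ_k ≤ (|C| + |D| + |C₁|)(s/r)λ₀`.
[folklore] -/
theorem spread_le_of_red_one {l0 lk m0 mk C D C1 s r : ℝ}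
    (hm0 : 0 < m0) (hl0 : 0 ≤ l0) (hs0 : 0 ≤ s) (hs1 : s ≤ 1) (hr : 1 ≤ r)
    (hONE : Real.exp (-(D * (s / r) + C1 * (s / r) ^ 2)) * m0 ≤ mk)
    (hRED : mk * l0 ≤ Real.exp (C * s ^ 2 / r) * (lk * m0)) :
    l0 - lk ≤ (|C| + |D| + |C1|) * (s / r) * l0 := by
  have hr0 : 0 < r := one_pos.trans_le hr
  have ht0 : 0 ≤ s / r := div_nonneg hs0 hr0.le
  have ht1 : s / r ≤ 1 := by
    rw [div_le_one hr0]
    exact hs1.trans hr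
  have hCs : C * s ^ 2 / r = C * s * (s / r) := by ring
  rw [hCs] at hRED
  have h1 : Real.exp (-(D * (s / r) + C1 * (s / r) ^ 2)) * m0 * l0 ≤ Real.exp (C * s * (s / r)) * (lk * m0) :=
    (mul_le_mul_of_nonneg_right hONE hl0).trans hRED
  have h2 : Real.exp (-(D * (s / r) + C1 * (s / r) ^ 2)) * l0 ≤ Real.exp (C * s * (s / r)) * lk := by
    have h1' : m0 * (Real.exp (-(D * (s / r) + C1 * (s / r) ^ 2)) * l0) ≤ m0 * (Real.exp (C * s * (s / r)) * lk) := by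
      calc m0 * (Real.exp (-(D * (s / r) + C1 * (s / r) ^ 2)) * l0)
          = Real.exp (-(D * (s / r) + C1 * (s / r) ^ 2)) * m0 * l0 := by ring
        _ ≤ Real.exp (C * s * (s / r)) * (lk * m0) := h1
        _ = m0 * (Real.exp (C * s * (s / r)) * lk) := by ring
    exact le_of_mul_le_mul_left h1' hm0
  have h3 : Real.exp (-(C * s * (s / r) + (D * (s / r) + C1 * (s / r) ^ 2))) * l0 ≤ lk := by
    have hpos : 0 ≤ Real.exp (-(C * s * (s / r))) := (Real.exp_pos _).le
    have h := mul_le_mul_of_nonneg_left h2 hpos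
    have e1 : Real.exp (-(C * s * (s / r))) * (Real.exp (-(D * (s / r) + C1 * (s / r) ^ 2)) * l0)
        = Real.exp (-(C * s * (s / r) + (D * (s / r) + C1 * (s / r) ^ 2))) * l0 := by
      rw [← mul_assoc, ← Real.exp_add]
      congr 1
      congr 1
      ring
    have e2 : Real.exp (-(C * s * (s / r))) * (Real.exp (C * s * (s / r)) * lk) = lk := by
      rw [← mul_assoc, ← Real.exp_add, neg_add_cancel, Real.exp_zero, one_mul]
    rw [e1, e2] at h
    exact h
  have h4 : l0 - lk ≤ l0 * (C * s * (s / r) + (D * (s / r) + C1 * (s / r) ^ 2)) := by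
    have hex : 1 - (C * s * (s / r) + (D * (s / r) + C1 * (s / r) ^ 2))
        ≤ Real.exp (-(C * s * (s / r) + (D * (s / r) + C1 * (s / r) ^ 2))) := by
      linarith [Real.add_one_le_exp (-(C * s * (s / r) + (D * (s / r) + C1 * (s / r) ^ 2)))]
    have h5 := mul_le_mul_of_nonneg_left hex hl0
    nlinarith [h5, h3]
  have h6 : C * s * (s / r) + (D * (s / r) + C1 * (s / r) ^ 2) ≤ (|C| + |D| + |C1|) * (s / r) := by
    have a1 : C * s * (s / r) ≤ |C| * (s / r) := by
      have : C * s ≤ |C| := by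
        calc C * s ≤ |C| * s := mul_le_mul_of_nonneg_right (le_abs_self C) hs0
          _ ≤ |C| * 1 := mul_le_mul_of_nonneg_left hs1 (abs_nonneg C)
          _ = |C| := mul_one _
      exact mul_le_mul_of_nonneg_right this ht0
    have a2 : D * (s / r) ≤ |D| * (s / r) := mul_le_mul_of_nonneg_right (le_abs_self D) ht0
    have a3 : C1 * (s / r) ^ 2 ≤ |C1| * (s / r) := by
      have hsq : (s / r) ^ 2 ≤ s / r := by nlinarith
      calc C1 * (s / r) ^ 2 ≤ |C1| * (s / r) ^ 2 := mul_le_mul_of_nonneg_right (le_abs_self C1) (sq_nonneg _)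
        _ ≤ |C1| * (s / r) := mul_le_mul_of_nonneg_left hsq (abs_nonneg C1)
    linarith
  calc l0 - lk ≤ l0 * (C * s * (s / r) + (D * (s / r) + C1 * (s / r) ^ 2)) := h4
    _ ≤ l0 * ((|C| + |D| + |C1|) * (s / r)) := mul_le_mul_of_nonneg_left h6 hl0
    _ = (|C| + |D| + |C1|) * (s / r) * l0 := by ring

/-- In the deep window, under RED ∧ ONE: the exact eigenfamily `φ₀ … φ_k` exists (`λ_k > 0`) and `u_i := φ_{i+1}` satisfies `PlateauClauses`
with the constant `C' := |C_RED| + |Δ_k| + |C_ONE|`.  (The common core of the two certificates below; §10 of `Lines/DressedRitzGEVP.lean`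
re-organised.) [cite: ReedSimonIV1978, Thm. XIII.1] -/
theorem exists_eigen_plateauClauses {k : ℕ} {C Ck B0 lam0 lam : ℝ}
    (hC : ∀ lam : ℝ, 0 < lam → lam ≤ lam0 → ∃ L0 : ℕ, ∀ (L : ℕ) [NeZero L], L0 ≤ L → ∀ β : ℝ,
      InFemtoWindow lam β L → ∀ j : ℕ, j ≤ k →
        levelValue su2Rep L β j * levelValue su2Rep 1 (oneSiteCoupling β L) 0 ≤
            Real.exp (C * luscherLambda β L ^ 2 / L) * (levelValue su2Rep 1 (oneSiteCoupling β L) j * levelValue su2Rep L β 0) ∧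
          levelValue su2Rep 1 (oneSiteCoupling β L) j * levelValue su2Rep L β 0 ≤
            Real.exp (C * luscherLambda β L ^ 2 / L) * (levelValue su2Rep L β j * levelValue su2Rep 1 (oneSiteCoupling β L) 0))
    (hB0 : ∀ B : ℝ, B0 ≤ B → 0 < levelValue su2Rep 1 B 0 ∧
      levelValue su2Rep 1 B k ≤ Real.exp (-(levelGap k * bareLambda B - Ck * bareLambda B ^ 2)) * levelValue su2Rep 1 B 0 ∧
      Real.exp (-(levelGap k * bareLambda B + Ck * bareLambda B ^ 2)) * levelValue su2Rep 1 B 0 ≤ levelValue su2Rep 1 B k)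
    (hlam : 0 < lam) (hle : lam ≤ min lam0 (min (1 / 2) (1 / (4 * max B0 1)))) :
    ∃ L0 : ℕ, ∀ (L : ℕ) [NeZero L], L0 ≤ L → ∀ β : ℝ, InFemtoWindow lam β L →
      ∃ φ : Fin (k + 1) → (GaugeConfig 3 L Theorems.FemtoTransferGap.SU2 → ℝ), (∀ i, IsPhys (φ i)) ∧
        (∀ i l, l2 (φ i) (φ l) = if i = l then 1 else 0) ∧
        (∀ i, transferApply β (φ i) = levelValue su2Rep L β i • φ i) ∧
        PlateauClauses k (|C| + |levelGap k| + |Ck|) β (fun i : Fin k => φ i.succ) := by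
  have hCC' : C ≤ |C| + |levelGap k| + |Ck| := by
    linarith [le_abs_self C, abs_nonneg (levelGap k), abs_nonneg Ck]
  have hC'0 : 0 ≤ |C| + |levelGap k| + |Ck| := by positivity
  obtain ⟨L0, hL⟩ := hC lam hlam (hle.trans (min_le_left _ _))
  refine ⟨L0, fun L _ hL0 β hW => ?_⟩
  have hlam_half : lam ≤ 1 / 2 := (hle.trans (min_le_right _ _)).trans (min_le_left _ _)
  have hlam1 : lam ≤ 1 := hlam_half.trans (by norm_num)
  have hlamB : lam ≤ 1 / (4 * max B0 1) := (hle.trans (min_le_right _ _)).trans (min_le_right _ _)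
  have hβ : (0 : ℝ) ≤ β := zero_le_one.trans hW.1
  have hlam_nn : 0 ≤ luscherLambda β L := luscherLambda_nonneg β L
  have hlpos : 0 < luscherLambda β L := luscherLambda_pos_of_window hlam hW
  have hΛ1 : luscherLambda β L ≤ 1 := by linarith [hW.2.2]
  have hL1 : (1 : ℝ) ≤ (L : ℝ) := by exact_mod_cast NeZero.one_le
  have hlv0 : 0 ≤ levelValue su2Rep L β 0 := levelValue_su2Rep_nonneg L hβ 0
  -- positivity of `λ_k`, then spectral attainment of the levels `0 … k`
  have hk : 0 < levelValue su2Rep L β k :=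
    levelValue_pos_of_red_one hlam hlam1 hlamB hW (fun B hB => ⟨(hB0 B hB).1, (hB0 B hB).2.2⟩)
      (hL L hL0 β hW k le_rfl).2
  obtain ⟨φ, hφ, hon, heig⟩ := exists_isPhys_eigenfamily hβ k hk
  -- the level-`k` spread from the lower laws of RED ∧ ONE
  have hsp : levelValue su2Rep L β 0 - levelValue su2Rep L β k
      ≤ (|C| + |levelGap k| + |Ck|) * (luscherLambda β L / L) * levelValue su2Rep L β 0 := by
    have hB0le : B0 ≤ oneSiteCoupling β L := oneSiteCoupling_ge_of_small_level hlam hlam1 hlamB hW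
    obtain ⟨hμ0, -, hlow⟩ := hB0 _ hB0le
    rw [bareLambda_oneSiteCoupling hlpos] at hlow
    exact spread_le_of_red_one hμ0 hlv0 hlam_nn hΛ1 hL1 hlow (hL L hL0 β hW k le_rfl).2
  exact ⟨φ, hφ, hon, heig, plateauClauses_of_eigen hβ hC'0 hCC' hon heig (fun j hj => hL L hL0 β hW j hj) hsp⟩

omit [NeZero L] in
/-- ★ **NON-VACUITY of the homogeneous cut: `RunningReduction → OneSiteLevels → OrthoPlateau`** (vacuum `φ₀`, vectors `φ_{i+1}`).
[cite: ReedSimonIV1978, Thm. XIII.1] -/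
theorem orthoPlateau_of_runningReduction_oneSiteLevels
    (hRED : Summit.QuantumFields.YangMills.Theses.LuscherReduction.RunningReduction)
    (hONE : Summit.QuantumFields.YangMills.Theses.LuscherReduction.OneSiteLevels) :
    OrthoPlateau := by
  intro k
  obtain ⟨C, lam0, hlam0, hC⟩ := runningReduction_uniform hRED k
  obtain ⟨Ck, B0, hB0⟩ := hONE k
  refine ⟨|C| + |levelGap k| + |Ck|, min lam0 (min (1 / 2) (1 / (4 * max B0 1))), by positivity,
    lt_min hlam0 (lt_min (by norm_num) (by positivity)), fun lam hlam hle => ?_⟩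
  obtain ⟨L0, hL⟩ := exists_eigen_plateauClauses hC hB0 hlam hle
  refine ⟨L0, fun L _ hL0 β hW => ?_⟩
  obtain ⟨φ, hφ, hon, heig, hcl⟩ := hL L hL0 β hW
  refine ⟨φ 0, hφ 0, ?_, ?_, fun i => φ i.succ, fun i => hφ i.succ, fun i => ?_, hcl⟩
  · rw [hon 0 0, if_pos rfl]
  · rw [heig 0, Fin.val_zero]
  · rw [hon 0 i.succ, if_neg (Fin.succ_ne_zero i).symm]

omit [NeZero L] in
/-- ★ **NON-VACUITY of the operator cut: `RunningReduction → OneSiteLevels → OperatorPlateau`.**  Vacuum: the Perron–Frobenius ground state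
`Ω ≥ c > 0` (`PhysL2.exists_groundState`); insertions `O_i := φ_{i+1}/Ω` (physical by `isPhys_div`), for which `ins Ω O_i = φ_{i+1}` EXACTLY,
because excited eigenfunctions are orthogonal to `Ω` (`K_β` symmetric, `λ_{i+1} ≤ λ₁ < λ₀`, `levelValue_one_lt_levelValue_zero`).
So the operator-language cut is implied by the route's two cruxes. [cite: ReedSimonIV1978, Thm. XIII.1] -/
theorem operatorPlateau_of_runningReduction_oneSiteLevels
    (hRED : Summit.QuantumFields.YangMills.Theses.LuscherReduction.RunningReduction)
    (hONE : Summit.QuantumFields.YangMills.Theses.LuscherReduction.OneSiteLevels) :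
    OperatorPlateau := by
  intro k
  obtain ⟨C, lam0, hlam0, hC⟩ := runningReduction_uniform hRED k
  obtain ⟨Ck, B0, hB0⟩ := hONE k
  refine ⟨|C| + |levelGap k| + |Ck|, min lam0 (min (1 / 2) (1 / (4 * max B0 1))), by positivity,
    lt_min hlam0 (lt_min (by norm_num) (by positivity)), fun lam hlam hle => ?_⟩
  obtain ⟨L0, hL⟩ := exists_eigen_plateauClauses hC hB0 hlam hle
  refine ⟨L0, fun L _ hL0 β hW => ?_⟩
  obtain ⟨φ, hφ, hon, heig, hcl⟩ := hL L hL0 β hW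
  have hβ : (0 : ℝ) ≤ β := zero_le_one.trans hW.1
  -- the Perron–Frobenius vacuum
  obtain ⟨Ω, θ, c, hΩ, hc, hcle, hΩ1, hKΩ, -, -, -⟩ := exists_groundState (L := L) β
  rw [← levelValue_zero] at hKΩ
  have hΩne : ∀ U, Ω U ≠ 0 := fun U => (hc.trans_le (hcle U)).ne'
  -- excited eigenfunctions are orthogonal to the vacuum
  have hperp : ∀ i : Fin k, l2 Ω (φ i.succ) = 0 := by
    intro i
    have h1 : l2 (transferApply β Ω) (φ i.succ) = l2 Ω (transferApply β (φ i.succ)) := l2_transferApply_comm β hΩ (hφ _)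
    rw [hKΩ, heig, l2_smul_left, l2_smul_right'] at h1
    have hlt : levelValue su2Rep L β i.succ < levelValue su2Rep L β 0 :=
      lt_of_le_of_lt (levelValue_antitone hβ (by rw [Fin.val_succ]; exact Nat.le_add_left 1 _))
        (levelValue_one_lt_levelValue_zero β)
    have h2 : (levelValue su2Rep L β 0 - levelValue su2Rep L β i.succ) * l2 Ω (φ i.succ) = 0 := by
      rw [sub_mul, h1, sub_self]
    exact (mul_eq_zero.mp h2).resolve_left (sub_ne_zero.mpr hlt.ne')
  have hins : (fun i : Fin k => ins Ω (φ i.succ / Ω)) = fun i : Fin k => φ i.succ := by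
    funext i
    rw [ins_div hΩne, hperp i, zero_smul, sub_zero]
  refine ⟨Ω, hΩ, hΩ1, hKΩ, fun i => φ i.succ / Ω, fun i => isPhys_div (hφ _) hΩ hc hcle, ?_⟩
  show PlateauClauses k (|C| + |levelGap k| + |Ck|) β (fun i : Fin k => ins Ω (φ i.succ / Ω))
  rw [hins]
  exact hcl

omit [NeZero L] in
/-- ★ With crux ONE closed in the tree (`oneSiteLevels_proof`): **`RunningReduction → OrthoPlateau`**. [cite: ReedSimonIV1978, Thm. XIII.1] -/
theorem orthoPlateau_of_runningReduction
    (hRED : Summit.QuantumFields.YangMills.Theses.LuscherReduction.RunningReduction) : OrthoPlateau :=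
  orthoPlateau_of_runningReduction_oneSiteLevels hRED oneSiteLevels_proof

omit [NeZero L] in
/-- ★ With crux ONE closed in the tree (`oneSiteLevels_proof`): **`RunningReduction → OperatorPlateau`** — the operator-language cut is implied by
RED alone, i.e. it is EXACTLY as strong as what it feeds (`OperatorPlateau → … → DressedRitz`, and RED ⟹ DressedRitz ⟹̸ RED).
[cite: ReedSimonIV1978, Thm. XIII.1] -/
theorem operatorPlateau_of_runningReduction
    (hRED : Summit.QuantumFields.YangMills.Theses.LuscherReduction.RunningReduction) : OperatorPlateau :=
  operatorPlateau_of_runningReduction_oneSiteLevels hRED oneSiteLevels_proof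

end Certificate

end Summit.QuantumFields.YangMills.Cruxes.RunningReduction.OpPlat

end
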